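import Literature.NumberTheory.EllipticCurves.KleinFrickeLevelNine
import Literature.NumberTheory.EllipticCurves.KleinFrickeLevelThirteen
import Literature.NumberTheory.EllipticCurves.KubertTateThirteen
import Literature.NumberTheory.EllipticCurves.OpenImageMazurInputs
import Literature.NumberTheory.EllipticCurves.TakahashiDegreeFormula
import Summits.ABC.ABC.Theses.DefiniteXi
import Literature.NumberTheory.EllipticCurves.GaloisAction
import HarnessLib

/-!
# STUB_IDEAS — `stub_pasten163` · ideator k=1 · gen 6 — companion sketch (helper signatures)

Crux stmt-ABC-11338 `DefiniteRTControlPrime` (route DefiniteXi), skeleton `Lines/Sketch.lean`,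
stub `stub_pasten163 : PastenShimura2024_minimalDegree_le_163_mul`.

Gen 6, HOME FAMILY 1 (recognise & import), new transfer: the only cite-only token left under the
stub after k2-g3/k2-g4's PROVED chain
`definiteRTControlPrime_of_rooted hT (freyIsogenyRadius163 h44 h13 h5)`
(`StubIdeasK2G3PastenLemma68`, `StubIdeasK2G4PastenLemma68`; trust base = Takahashi 2.3 +
Mazur Cor. 4.4 + Klein–Fricke 13 + Frey-5 (tree)) that is CLASSICAL and certificate-provable is
`h13 : kleinFrickeThirteen_exists_j_eq` (Klein–Fricke at level 13, `KleinFrickeLevelThirteen.lean`,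
"Typed ≠ proved").  This file types the helper lemmas of its in-tree DISCHARGE by porting the PROVED
level-9 method (`KleinFrickeLevelNine.lean`: Kubert coordinate at a torsion point → deck-invariant
Hauptmodul → Galois descent) onto the PROVED raw plane model of `X₁(13)`
(`KubertTateThirteen.lean`: `kubertTate_addOrderOf_zero_eq_thirteen_iff[_raw]`).

Explicit data (jobs j344772 / j344782 / j344788, GP; each map recognised over `F_p` as a unit
monomial in the cusp units of `X₁(13)` and then checked EXACTLY in the function field
`ℚ(r)[s]/(F₁₃)`; certificate sizes measured as `LHS - RHS = q·F₁₃` with integer `q`):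
* Hauptmodul of `X₀(13)` on the raw `X₁(13)` (`F₁₃(r,s) = 0`, Sutherland's coordinates):
  `τ(r,s) = (s-1)·((r-1)²s³ + (-8r²+5r+3)s² + (16r²-20r+3)s + 1) / (rs⁴ + (r²-3r)s³ + (-5r²+6r)s² + (6r²-7r+1)s + (-r²+r))`
  with `j(E(rs(r-1), s(r-1))) = (τ²+5τ+13)(τ⁴+7τ³+20τ²+19τ+1)³/τ` — EXACTLY the shape of
  `kleinFrickeThirteen_exists_j_eq` (domain side, no `13/t` flip);
* deck transformations `P ↦ 4P`, `P ↦ 5P` (generating `(ℤ/13)ˣ/±1 ≅ C₆`; `4` has order 3, `5` order 2):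
  `α₄(r,s) = ((s-1)(rs³-3rs²+(4r-1)s-r²)/((s-r)(rs-2r+1)), ((r+1)s²-3rs+r)/((s-1)(rs-2r+1)))`,
  `α₅(r,s) = ((rs-2r+1)/(r(s-r)), (s-1)(s-r)/((r+1)s²-3rs+r))`
  (`α₂` alone also generates — `2` is a primitive root mod 13 — but its B4 cofactor has 806
  monomials against 123 + 72 for `{α₄, α₅}`);
* `Δ(E(rs(r-1), s(r-1))) = (r-1)⁵ r³ s⁴ · A(r,s)` with `A = numerator(τ)/(s-1)` (B7a, PROVED), and
  Bézout certificates `U·u + V·F₁₃ = ±(r-1)^a r^b` for the cusp units `u` in the denominators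
  (B7b, PROVED);
* sizes: B3 (coordinates of `4P`, `5P`): cofactors of 52/32 and 87/88 monomials; B4 (`τ∘α = τ`):
  123 and 72 monomials; B5 (`j·τ = (τ²+5τ+13)(τ⁴+…)³ mod F₁₃`): `q` has 2187 monomials, total
  degree 95, coefficients `< 2^87` — the size class of the LANDED level-7 kernel certificate
  (`KleinFrickeSevenCertificateKernel`: cofactors of 2605 monomials, `decide +kernel`).

PROVED here (0 sorry): B1 `tateR` + `negY`/`toXY`/Galois lemmas, B1′ general-`u` invariance of
`r, s`, B2a (scaling `[A₁,A₂,A₃,0,0]` to `E(b,c)`), B7a, B7b, the isogeny packaging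
`Isogeny.exists_hauptmodul_thirteen_of_degree_eq` (from B6) and
`kleinFrickeThirteen_exists_j_eq_holds : kleinFrickeThirteen_exists_j_eq` (from B6).
`sorry` only in the 10 helper bodies B2, B3core₄/₅, B3₄/₅, B4₄/₅, B5, B7c, B6 (sizes S/M/L marked).
-/

noncomputable section

open scoped Classical

universe u

namespace WeierstrassCurve

variable {F : Type u} [Field F] (W : WeierstrassCurve F) {L : Type u} [Field L] [Algebra F L]

/-! ## B1 (S) — Sutherland's `r`-coordinate of a marked point (`s` IS the tree's `tateNine`)

`b = -A₂³/A₃²`, `c = 1 - A₁A₂/A₃` (Tate normal form of `(W, P)`), `r = b/c`, `s = c²/(b - c)`;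
so `r(P) = -A₂³/(A₃(A₃ - A₁A₂))` and `s(P) = tateNine` (already in the tree). -/

/-- Sutherland's `r = b/c` at the marked point `(x, y)`, as a rational function of the tangent
coefficients `A₁, A₂, A₃` (`KleinFrickeLevelNine` §2). [cite: Sutherland2012, §2] -/
def tateR (x y : F) : F :=
  -(W.tgA₂ x y) ^ 3 / (W.tgA₃ x y * (W.tgA₃ x y - W.tgA₁ x y * W.tgA₂ x y))

variable {W}

/-- PROVED. `r(-P) = r(P)`. -/
theorem tateR_negY {x y : F} (hy : y ≠ W.toAffine.negY x y) :
    W.tateR x (W.toAffine.negY x y) = W.tateR x y := by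
  rw [tateR, tateR, tgA₁_negY hy, tgA₂_negY hy, tgA₃_negY]
  ring

/-- PROVED. `r` is unchanged by a change of variables with `u = 1`. -/
theorem tateR_toXY (C : VariableChange F) (hu : C.u = 1) {x y : F}
    (h : W.toAffine.Equation x y) (hy : y ≠ W.toAffine.negY x y) :
    (C • W).tateR (C.toX x) (C.toY x y) = W.tateR x y := by
  rw [tateR, tateR, tgA₁_toXY C hu h hy, tgA₂_toXY C hu h hy, tgA₃_toXY C hu]

/-- PROVED. `r` is Galois-equivariant. -/
theorem map_tateR (σ : L →ₐ[F] L) (x y : L) :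
    σ ((W.baseChange L).tateR x y) = (W.baseChange L).tateR (σ x) (σ y) := by
  have ha₁ : σ (W.baseChange L).a₁ = (W.baseChange L).a₁ := σ.commutes W.a₁
  have ha₂ : σ (W.baseChange L).a₂ = (W.baseChange L).a₂ := σ.commutes W.a₂
  simp only [tateR, tgA₁, tgA₂, tgA₃, map_div₀, map_neg, map_pow, map_sub, map_add, map_mul,
    map_ofNat, ha₁, ha₂, Affine.baseChange_slope, Affine.baseChange_negY]

/-- PROVED. General-`u` scaling of the tangent coefficient `A₁` (`A₁ ↦ u⁻¹A₁`). -/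
theorem tgA₁_toXY' (C : VariableChange F) {x y : F} (h : W.toAffine.Equation x y)
    (hy : y ≠ W.toAffine.negY x y) :
    (C • W).tgA₁ (C.toX x) (C.toY x y) = (C.u : F)⁻¹ * W.tgA₁ x y := by
  rw [tgA₁, tgA₁, VariableChange.slope_toXY W C h h (fun hh => hy hh.2)]
  simp only [variableChange_a₁, Units.val_inv_eq_inv_val]
  ring

/-- PROVED. `A₂ ↦ u⁻²A₂`. -/
theorem tgA₂_toXY' (C : VariableChange F) {x y : F} (h : W.toAffine.Equation x y)
    (hy : y ≠ W.toAffine.negY x y) :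
    (C • W).tgA₂ (C.toX x) (C.toY x y) = ((C.u : F)⁻¹) ^ 2 * W.tgA₂ x y := by
  rw [tgA₂, tgA₂, VariableChange.slope_toXY W C h h (fun hh => hy hh.2)]
  simp only [VariableChange.toX, variableChange_a₁, variableChange_a₂, Units.val_inv_eq_inv_val]
  ring

/-- PROVED. `A₃ ↦ u⁻³A₃`. -/
theorem tgA₃_toXY' (C : VariableChange F) (x y : F) :
    (C • W).tgA₃ (C.toX x) (C.toY x y) = ((C.u : F)⁻¹) ^ 3 * W.tgA₃ x y := by
  rw [tgA₃, tgA₃, VariableChange.negY_toXY]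
  simp only [VariableChange.toY, Units.val_inv_eq_inv_val]
  ring

/-- **B1′ — PROVED.** `r` is an invariant of the PAIR `(W, P)`: unchanged by ANY change of
variables (weights cancel).  Used to pass from the `u = 1` normal form `[A₁, A₂, A₃, 0, 0]` to
`E(b, c)` (B2a). -/
theorem tateR_toXY' (C : VariableChange F) {x y : F}
    (h : W.toAffine.Equation x y) (hy : y ≠ W.toAffine.negY x y) :
    (C • W).tateR (C.toX x) (C.toY x y) = W.tateR x y := by
  rw [tateR, tateR, tgA₁_toXY' C h hy, tgA₂_toXY' C h hy, tgA₃_toXY' C]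
  have hu : (C.u : F) ≠ 0 := C.u.ne_zero
  field_simp

/-- **B1′ — PROVED.** Same for `s = tateNine`. -/
theorem tateNine_toXY' (C : VariableChange F) {x y : F}
    (h : W.toAffine.Equation x y) (hy : y ≠ W.toAffine.negY x y) :
    (C • W).tateNine (C.toX x) (C.toY x y) = W.tateNine x y := by
  rw [tateNine, tateNine, tgA₁_toXY' C h hy, tgA₂_toXY' C h hy, tgA₃_toXY' C]
  have hu : (C.u : F) ≠ 0 := C.u.ne_zero
  field_simp

/-! ## B2 (M) — the order-13 relation at a point: `F₁₃(r(P), s(P)) = 0` -/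

/-- **B2a — PROVED.** Scaling the normal form `[A₁, A₂, A₃, 0, 0]` (`A₂A₃ ≠ 0`) by `u = A₃/A₂` gives
`E(b, c)` with `b = -A₂³/A₃²`, `c = 1 - A₁A₂/A₃` (Knapp (5.28)→E(b,c); cf. the tree's
`exists_variableChange_eq_kubertTate`, whose `C` does this in one stroke). -/
theorem variableChange_scale_eq_kubertTate (A₁ A₂ A₃ : F) (h₂ : A₂ ≠ 0) (h₃ : A₃ ≠ 0) :
    (⟨Units.mk0 (A₃ / A₂) (div_ne_zero h₃ h₂), 0, 0, 0⟩ : VariableChange F) •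
        (⟨A₁, A₂, A₃, 0, 0⟩ : WeierstrassCurve F) =
      kubertTate (-A₂ ^ 3 / A₃ ^ 2) (1 - A₁ * A₂ / A₃) := by
  ext <;> simp only [variableChange_a₁, variableChange_a₂, variableChange_a₃, variableChange_a₄,
    variableChange_a₆, kubertTate, Units.val_inv_eq_inv_val, Units.val_mk0] <;> field_simp <;> ring

/-- **B2 (M).** At a point `P = (x₀, y₀)` of order `13`: `(r, s) = (r(P), s(P))` is nondegenerate
(`r ∉ {0,1}`, `s ∉ {0,1}`, `r ≠ s`) and lies on the raw `X₁(13)`: `F₁₃(r, s) = 0`.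
Proof: normalise at `P` by `C_P = (1, x₀, λ_P, y₀)` (`variableChange_tangent_eq`,
`pointEquiv_tangent_some`: `P ↦ (0,0)` on `[A₁,A₂,A₃,0,0]`), `A₃ ≠ 0` (else `2P = 0`), `A₂ ≠ 0`
(else `3P = 0`), scale by B2a, transport `addOrderOf` along `VariableChange.pointEquiv`
(an `≃+`), then `kubertTate_addOrderOf_zero_eq_thirteen_iff` + `exists_kubertTate_param` /
`kubertTateX₁₃_eq_mul_raw`, reading `b/c`, `c²/(b-c)` through B1/B1′. -/
theorem kubertTateRaw₁₃_of_addOrderOf_eq_thirteen {x₀ y₀ : F} {h : W.toAffine.Nonsingular x₀ y₀}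
    (h13 : addOrderOf (Affine.Point.some x₀ y₀ h : W.toAffine.Point) = 13) :
    W.tateR x₀ y₀ ≠ 0 ∧ W.tateR x₀ y₀ ≠ 1 ∧ W.tateNine x₀ y₀ ≠ 0 ∧ W.tateNine x₀ y₀ ≠ 1 ∧
      W.tateR x₀ y₀ ≠ W.tateNine x₀ y₀ ∧
      kubertTateRaw₁₃ (W.tateR x₀ y₀) (W.tateNine x₀ y₀) = 0 := by
  sorry

/-! ## B3 (M) — the deck transformations `P ↦ 4P`, `P ↦ 5P` in the coordinates `(r, s)` -/

/-- `r(4P)` on `F₁₃ = 0` (job j344759: unit monomial, exact mod `F₁₃`). -/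
def deckFourR (r s : F) : F :=
  (s - 1) * (r * s ^ 3 - 3 * r * s ^ 2 + (4 * r - 1) * s - r ^ 2) / ((s - r) * (r * s - 2 * r + 1))

/-- `s(4P)` on `F₁₃ = 0`. -/
def deckFourS (r s : F) : F :=
  ((r + 1) * s ^ 2 - 3 * r * s + r) / ((s - 1) * (r * s - 2 * r + 1))

/-- `r(5P)` on `F₁₃ = 0`. -/
def deckFiveR (r s : F) : F := (r * s - 2 * r + 1) / (r * (s - r))

/-- `s(5P)` on `F₁₃ = 0`. -/
def deckFiveS (r s : F) : F := (s - 1) * (s - r) / ((r + 1) * s ^ 2 - 3 * r * s + r)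

/-- **B3core₄ (S–M).** On `E(rs(r-1), s(r-1))` with `F₁₃(r,s) = 0`, the Kubert–Sutherland
coordinates of the marked point `4·(0,0) = (r(r-1), r²(r-1)(s-1))` (`kubertTate_four_nsmul_zero`)
are `α₄(r, s)`.  A rational-function identity modulo `F₁₃` (`field_simp` +
`linear_combination q * hF`; job j344772: the cofactors `q` have 52 and 32 monomials, total degree
13 / 10, coefficients `< 2^9`). Denominator hypotheses are the cusp units at `4P` (B7b). -/
theorem tate_four_nsmul_kubertTate {r s : F} (hF : kubertTateRaw₁₃ r s = 0)
    (hr : r ≠ 0) (hr₁ : r ≠ 1) (hs : s ≠ 0) (hs₁ : s ≠ 1) (hrs : r ≠ s)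
    (hu₁ : r * s - 2 * r + 1 ≠ 0) (hu₂ : (r + 1) * s ^ 2 - 3 * r * s + r ≠ 0) :
    (kubertTate (r * s * (r - 1)) (s * (r - 1))).tateR (r * (r - 1)) (r ^ 2 * (r - 1) * (s - 1)) =
        deckFourR r s ∧
      (kubertTate (r * s * (r - 1)) (s * (r - 1))).tateNine (r * (r - 1))
          (r ^ 2 * (r - 1) * (s - 1)) = deckFourS r s := by
  sorry

/-- **B3core₅ (S–M).** Same at `5·(0,0) = (rs(s-1), rs²(r-s))` (`kubertTate_five_nsmul_zero`;
cofactors 87 / 88 monomials, degree 18, coefficients `< 2^13`). -/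
theorem tate_five_nsmul_kubertTate {r s : F} (hF : kubertTateRaw₁₃ r s = 0)
    (hr : r ≠ 0) (hr₁ : r ≠ 1) (hs : s ≠ 0) (hs₁ : s ≠ 1) (hrs : r ≠ s)
    (hu₁ : r * s - 2 * r + 1 ≠ 0) (hu₂ : (r + 1) * s ^ 2 - 3 * r * s + r ≠ 0) :
    (kubertTate (r * s * (r - 1)) (s * (r - 1))).tateR (r * s * (s - 1)) (r * s ^ 2 * (r - s)) =
        deckFiveR r s ∧
      (kubertTate (r * s * (r - 1)) (s * (r - 1))).tateNine (r * s * (s - 1))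
          (r * s ^ 2 * (r - s)) = deckFiveS r s := by
  sorry

/-- **B3 (M), point level.** For `Q` of order `13` on any `V/F` and `k ∈ {4, 5}`:
`(r, s)(kQ) = α_k(r(Q), s(Q))` — from B3core via the normalisation of B2 (`C_Q`, B2a, B1/B1′,
`VariableChange.pointEquiv` is additive so `kQ ↦ k·(0,0)`). Stated for `k = 4`; `k = 5` alike. -/
theorem tate_four_nsmul_of_addOrderOf_eq_thirteen {x₀ y₀ : F} {h : W.toAffine.Nonsingular x₀ y₀}
    (h13 : addOrderOf (Affine.Point.some x₀ y₀ h : W.toAffine.Point) = 13)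
    {x₄ y₄ : F} {h₄ : W.toAffine.Nonsingular x₄ y₄}
    (hQ : (4 : ℕ) • (Affine.Point.some x₀ y₀ h : W.toAffine.Point) = .some x₄ y₄ h₄) :
    W.tateR x₄ y₄ = deckFourR (W.tateR x₀ y₀) (W.tateNine x₀ y₀) ∧
      W.tateNine x₄ y₄ = deckFourS (W.tateR x₀ y₀) (W.tateNine x₀ y₀) := by
  sorry

theorem tate_five_nsmul_of_addOrderOf_eq_thirteen {x₀ y₀ : F} {h : W.toAffine.Nonsingular x₀ y₀}
    (h13 : addOrderOf (Affine.Point.some x₀ y₀ h : W.toAffine.Point) = 13)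
    {x₅ y₅ : F} {h₅ : W.toAffine.Nonsingular x₅ y₅}
    (hQ : (5 : ℕ) • (Affine.Point.some x₀ y₀ h : W.toAffine.Point) = .some x₅ y₅ h₅) :
    W.tateR x₅ y₅ = deckFiveR (W.tateR x₀ y₀) (W.tateNine x₀ y₀) ∧
      W.tateNine x₅ y₅ = deckFiveS (W.tateR x₀ y₀) (W.tateNine x₀ y₀) := by
  sorry

/-! ## B4 (S–M) — the Hauptmodul `τ` of `X₀(13)` on the raw `X₁(13)` and its deck invariance -/

/-- Numerator of `τ`: `(s-1)·((r-1)²s³ + (-8r²+5r+3)s² + (16r²-20r+3)s + 1)`. -/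
def hauptThirteenNum (r s : F) : F :=
  (s - 1) * ((r - 1) ^ 2 * s ^ 3 + (-8 * r ^ 2 + 5 * r + 3) * s ^ 2 + (16 * r ^ 2 - 20 * r + 3) * s + 1)

/-- Denominator of `τ`: `rs⁴ + (r²-3r)s³ + (-5r²+6r)s² + (6r²-7r+1)s + (-r²+r)`. -/
def hauptThirteenDen (r s : F) : F :=
  r * s ^ 4 + (r ^ 2 - 3 * r) * s ^ 3 + (-5 * r ^ 2 + 6 * r) * s ^ 2 + (6 * r ^ 2 - 7 * r + 1) * s +
    (-r ^ 2 + r)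

/-- **The Hauptmodul `τ` of `X₀(13)`** pulled back to Sutherland's raw `X₁(13)` (job j344759:
recognised from 96 `F_p`-points as a unit monomial in the cusp units, verified exactly;
`13/τ` is the Atkin–Lehner image). [cite: Maier2009, Table 4 (N = 13)] [cite: Sutherland2012, §2] -/
def hauptmodulThirteen (r s : F) : F := hauptThirteenNum r s / hauptThirteenDen r s

/-- **B4₄ (S–M).** `τ ∘ α₄ = τ` on `F₁₃ = 0` (job j344772: verified exactly in the function field;
cofactor `q`: 123 monomials, total degree 22, coefficients `< 2^17` — `linear_combination` size). -/
theorem hauptmodulThirteen_deckFour {r s : F} (hF : kubertTateRaw₁₃ r s = 0)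
    (hr : r ≠ 0) (hr₁ : r ≠ 1) (hs : s ≠ 0) (hs₁ : s ≠ 1) (hrs : r ≠ s)
    (hu₁ : r * s - 2 * r + 1 ≠ 0) (hu₂ : (r + 1) * s ^ 2 - 3 * r * s + r ≠ 0)
    (hD : hauptThirteenDen r s ≠ 0) :
    hauptmodulThirteen (deckFourR r s) (deckFourS r s) = hauptmodulThirteen r s := by
  sorry

/-- **B4₅ (S–M).** `τ ∘ α₅ = τ` on `F₁₃ = 0` (cofactor: 72 monomials, degree 16, coefficients `< 2^12`). -/
theorem hauptmodulThirteen_deckFive {r s : F} (hF : kubertTateRaw₁₃ r s = 0)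
    (hr : r ≠ 0) (hr₁ : r ≠ 1) (hs : s ≠ 0) (hs₁ : s ≠ 1) (hrs : r ≠ s)
    (hu₁ : r * s - 2 * r + 1 ≠ 0) (hu₂ : (r + 1) * s ^ 2 - 3 * r * s + r ≠ 0)
    (hD : hauptThirteenDen r s ≠ 0) :
    hauptmodulThirteen (deckFiveR r s) (deckFiveS r s) = hauptmodulThirteen r s := by
  sorry

/-! ## B5 (M–L) — Fricke's rational modular equation of level 13 on the raw `X₁(13)` -/

/-- **B5 (M–L).** `j(E(rs(r-1), s(r-1))) · τ = (τ²+5τ+13)(τ⁴+7τ³+20τ²+19τ+1)³` on `F₁₃ = 0`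
(Fricke 1922 II.4 §5 (16); Maier Table 4, `N = 13`).  The map `X₁(13) → X(1)` has degree `84`
(vs `24` at level 7, `36` at level 9), so the polynomial certificate `LHS - RHS = q · F₁₃` is large:
use the tree's KERNEL certificate checker `PolyCert.eval_eq_zero_of_evalK_eq_zero`
(`KleinFrickeSevenCertificateKernel.lean`; pad monomials `rⁱsʲ ↦ (a,b,x) = (r,s,1)` to a common
weight, `T = 2^300`, `M = 128`, `decide +kernel`) rather than `linear_combination`: job j344772
measured `LHS - RHS` = 2480 monomials (total degree 101) and `q` = 2187 monomials, total degree 95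
(`deg_r 37 < M`, `deg_s 64`), integer coefficients `< 2^87` (`outputs/B5_cofactor_q.txt`); the
`(b,c)`-chart version mod `X₁₃(b,c)` is worse (q: 3487 monomials, degree 141). -/
theorem j_mul_hauptmodulThirteen {r s : F} (hF : kubertTateRaw₁₃ r s = 0)
    (hr : r ≠ 0) (hr₁ : r ≠ 1) (hs : s ≠ 0) (hs₁ : s ≠ 1) (hrs : r ≠ s)
    (hD : hauptThirteenDen r s ≠ 0)
    [(kubertTate (r * s * (r - 1)) (s * (r - 1))).IsElliptic] :
    (kubertTate (r * s * (r - 1)) (s * (r - 1))).j * hauptmodulThirteen r s =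
      (hauptmodulThirteen r s ^ 2 + 5 * hauptmodulThirteen r s + 13) *
        (hauptmodulThirteen r s ^ 4 + 7 * hauptmodulThirteen r s ^ 3 +
          20 * hauptmodulThirteen r s ^ 2 + 19 * hauptmodulThirteen r s + 1) ^ 3 := by
  sorry

/-! ## B7 (S) — nonvanishing of the cusp units at an order-13 point of an ELLIPTIC curve

Two mechanisms, both with tiny certificates (job j344782):
* `Δ(E(rs(r-1), s(r-1))) = (r-1)⁵ r³ s⁴ · A(r,s)` EXACTLY (`A = hauptThirteenNum/(s-1)`), so
  `A ≠ 0 ⟸ IsElliptic` (the level-9 `hD` trick) — PROVED below by `ring`;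
* for `u ∈ {rs-2r+1, (r+1)s²-3rs+r, rs³-3rs²+(4r-1)s-r², D = hauptThirteenDen}`:
  `Res_s(u, F₁₃) = (r-1)^a r^b` (`(a,b) = (6,1), (8,2), (12,2), (17,2)`), with Bézout cofactors of
  `12/1, 28/13, 41/27, 57/57` terms (job j344788 prints `U, V` with `U·u + V·F₁₃ = (r-1)^a r^b`):
  `u = 0 ∧ F₁₃ = 0 ⟹ r ∈ {0, 1}`, excluded by B2. -/

/-- **B7a — PROVED.** The discriminant of `E(rs(r-1), s(r-1))` factors through the numerator of `τ`. -/
theorem kubertTate_Δ_thirteen (r s : F) :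
    (kubertTate (r * s * (r - 1)) (s * (r - 1))).Δ =
      (r - 1) ^ 5 * r ^ 3 * s ^ 4 *
        ((r - 1) ^ 2 * s ^ 3 + (-8 * r ^ 2 + 5 * r + 3) * s ^ 2 + (16 * r ^ 2 - 20 * r + 3) * s + 1) := by
  rw [kubertTate_Δ]
  ring

set_option maxHeartbeats 4000000 in
set_option maxRecDepth 16384 in
/-- **B7b — PROVED** (Bézout certificates from job j344788, checked by `ring`). The exotic cusp
units needed by B3/B4 and the denominator `D` of `τ` do not vanish on `F₁₃ = 0`, `r ∉ {0, 1}`. -/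
theorem cuspUnits_ne_zero_of_kubertTateRaw₁₃ {r s : F} (hF : kubertTateRaw₁₃ r s = 0)
    (hr : r ≠ 0) (hr₁ : r ≠ 1) :
    r * s - 2 * r + 1 ≠ 0 ∧ (r + 1) * s ^ 2 - 3 * r * s + r ≠ 0 ∧
      r * s ^ 3 - 3 * r * s ^ 2 + (4 * r - 1) * s - r ^ 2 ≠ 0 ∧ hauptThirteenDen r s ≠ 0 := by
  have hr₁' : r - 1 ≠ 0 := sub_ne_zero.mpr hr₁
  have hF' : (r - s) ^ 3 - r * (s - 1) ^ 3 * (r * s - 2 * r + 1) = 0 := hF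
  refine ⟨?_, ?_, ?_, ?_⟩
  · -- Bézout: (r - 1) ^ 6 * r = U·u + V·F₁₃ (job j344788, atom u45)
    intro hu
    have key : (r - 1) ^ 6 * r =
        (r^5*s^3 + (-3*r^5 + r^3)*s^2 + (3*r^5 - 3*r^4 + 2*r^3 - r^2)*s + (2*r^5 - 6*r^4 + 7*r^3 - 4*r^2 + r)) * (r * s - 2 * r + 1) +
        (r^4) * ((r - s) ^ 3 - r * (s - 1) ^ 3 * (r * s - 2 * r + 1)) := by ring
    rw [hF', hu, mul_zero, mul_zero, add_zero] at key
    exact (mul_ne_zero (pow_ne_zero 6 hr₁') hr) key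
  · -- Bézout: (r - 1) ^ 8 * r ^ 2 = U·u + V·F₁₃ (job j344788, atom w45)
    intro hu
    have key : (r - 1) ^ 8 * r ^ 2 =
        ((4*r^7 - 6*r^6 + 8*r^5 - 7*r^4 + 2*r^3)*s^3 + (r^8 - 17*r^7 + 31*r^6 - 41*r^5 + 35*r^4 - 8*r^3 - 5*r^2 + 2*r)*s^2 + (-2*r^8 + 24*r^7 - 64*r^6 + 103*r^5 - 102*r^4 + 54*r^3 - 13*r^2 + r)*s + (2*r^8 - 7*r^7 + 14*r^6 - 20*r^5 + 17*r^4 - 7*r^3 + r^2)) * ((r + 1) * s ^ 2 - 3 * r * s + r) +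
        ((4*r^6 - 2*r^5 + 2*r^4 + r^3 - 5*r^2 + 2*r)*s + (r^7 - 8*r^6 + 18*r^5 - 26*r^4 + 20*r^3 - 7*r^2 + r)) * ((r - s) ^ 3 - r * (s - 1) ^ 3 * (r * s - 2 * r + 1)) := by ring
    rw [hF', hu, mul_zero, mul_zero, add_zero] at key
    exact (mul_ne_zero (pow_ne_zero 8 hr₁') (pow_ne_zero 2 hr)) key
  · -- Bézout: -((r - 1) ^ 12 * r ^ 2) = U·u + V·F₁₃ (job j344788, atom c4p)
    intro hu
    have key : -((r - 1) ^ 12 * r ^ 2) =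
        ((r^11 + 2*r^10 - 7*r^9 - 6*r^8 + 29*r^7 - 32*r^6 + 18*r^5 - 6*r^4 + r^3)*s^3 + (-2*r^11 - 8*r^10 + 12*r^9 + 68*r^8 - 185*r^7 + 189*r^6 - 93*r^5 + 16*r^4 + 7*r^3 - 5*r^2 + r)*s^2 + (4*r^11 - 14*r^10 + 61*r^9 - 210*r^8 + 402*r^7 - 456*r^6 + 330*r^5 - 156*r^4 + 45*r^3 - 6*r^2)*s + (r^12 - 7*r^11 + 36*r^10 - 125*r^9 + 271*r^8 - 378*r^7 + 353*r^6 - 225*r^5 + 96*r^4 - 25*r^3 + 3*r^2)) * (r * s ^ 3 - 3 * r * s ^ 2 + (4 * r - 1) * s - r ^ 2) +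
        ((r^10 + 2*r^9 - 7*r^8 - 6*r^7 + 29*r^6 - 32*r^5 + 18*r^4 - 6*r^3 + r^2)*s^2 + (-5*r^9 - 5*r^8 + 61*r^7 - 114*r^6 + 102*r^5 - 54*r^4 + 18*r^3 - 3*r^2)*s + (5*r^10 - 20*r^9 + 50*r^8 - 104*r^7 + 156*r^6 - 155*r^5 + 101*r^4 - 42*r^3 + 10*r^2 - r)) * ((r - s) ^ 3 - r * (s - 1) ^ 3 * (r * s - 2 * r + 1)) := by ring
    rw [hF', hu, mul_zero, mul_zero, add_zero] at key
    exact (neg_ne_zero.mpr (mul_ne_zero (pow_ne_zero 12 hr₁') (pow_ne_zero 2 hr))) key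
  · -- Bézout: -((r - 1) ^ 17 * r ^ 2) = U·u + V·F₁₃ (job j344788, atom Dtau)
    intro hu
    unfold hauptThirteenDen at hu
    have key : -((r - 1) ^ 17 * r ^ 2) =
        ((-3*r^15 - r^14 + 59*r^13 - 191*r^12 + 344*r^11 - 493*r^10 + 621*r^9 - 616*r^8 + 430*r^7 - 200*r^6 + 60*r^5 - 11*r^4 + r^3)*s^3 + (4*r^15 + 44*r^14 - 341*r^13 + 996*r^12 - 1845*r^11 + 2750*r^10 - 3466*r^9 + 3334*r^8 - 2159*r^7 + 796*r^6 - 62*r^5 - 86*r^4 + 44*r^3 - 10*r^2 + r)*s^2 + (-r^16 + 8*r^15 - 104*r^14 + 600*r^13 - 1941*r^12 + 4309*r^11 - 7277*r^10 + 9597*r^9 - 9728*r^8 + 7397*r^7 - 4134*r^6 + 1663*r^5 - 464*r^4 + 82*r^3 - 7*r^2)*s + (-15*r^15 + 125*r^14 - 505*r^13 + 1356*r^12 - 2742*r^11 + 4340*r^10 - 5352*r^9 + 5061*r^8 - 3619*r^7 + 1932*r^6 - 755*r^5 + 207*r^4 - 36*r^3 + 3*r^2)) * (r * s ^ 4 +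 (r ^ 2 - 3 * r) * s ^ 3 + (-5 * r ^ 2 + 6 * r) * s ^ 2 + (6 * r ^ 2 - 7 * r + 1) * s + (-r ^ 2 + r)) +
        ((-3*r^14 - r^13 + 59*r^12 - 191*r^11 + 344*r^10 - 493*r^9 + 621*r^8 - 616*r^7 + 430*r^6 - 200*r^5 + 60*r^4 - 11*r^3 + r^2)*s^3 + (-3*r^15 - 3*r^14 + 104*r^13 - 410*r^12 + 900*r^11 - 1518*r^10 + 2232*r^9 - 2691*r^8 + 2404*r^7 - 1504*r^6 + 642*r^5 - 183*r^4 + 33*r^3 - 3*r^2)*s^2 + (3*r^15 + 42*r^14 - 361*r^13 + 1240*r^12 - 2761*r^11 + 4801*r^10 - 6777*r^9 + 7419*r^8 - 5986*r^7 + 3451*r^6 - 1394*r^5 + 385*r^4 - 68*r^3 + 6*r^2)*s + (-r^16 + 15*r^15 - 120*r^14 + 565*r^13 - 1760*r^12 + 3964*r^11 - 6786*r^10 + 8994*r^9 - 9228*r^8 + 7273*r^7 - 4354*r^6 + 1946*r^5 - 629*r^4 + 138*r^3 - 18*r^2 + r)) * ((r - s) ^ 3 - r * (s - 1) ^ 3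 * (r * s - 2 * r + 1)) := by ring
    rw [hF', hu, mul_zero, mul_zero, add_zero] at key
    exact (neg_ne_zero.mpr (mul_ne_zero (pow_ne_zero 17 hr₁') (pow_ne_zero 2 hr))) key

/-- **B7c (S).** Hence at a point of order `13` on an elliptic curve: `τ(r(P), s(P))` has nonzero
numerator and denominator (B2 + B7a via B2a/`variableChange_Δ` + B7b). -/
theorem hauptmodul_atoms_ne_zero_of_addOrderOf_eq_thirteen [W.IsElliptic] {x₀ y₀ : F}
    {h : W.toAffine.Nonsingular x₀ y₀}
    (h13 : addOrderOf (Affine.Point.some x₀ y₀ h : W.toAffine.Point) = 13) :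
    hauptThirteenDen (W.tateR x₀ y₀) (W.tateNine x₀ y₀) ≠ 0 ∧
      hauptThirteenNum (W.tateR x₀ y₀) (W.tateNine x₀ y₀) ≠ 0 := by
  sorry

/-! ## B6 (M) — Galois descent of `τ(P)` and the packaging (level-9 `§6` verbatim, `9 ↦ 13`)

`σ ∈ Gal(L/F)` moves `P` to `σP = kP`, `k ∈ (ℤ/13)ˣ = ±⟨4, 5⟩`; `τ(kP) = τ(P)` by B3+B4 at the
order-13 points `Q, 4Q, 5Q, …` and `τ(-Q) = τ(Q)` (`tateR_negY`, `tateNine_negY`); `τ(σP) = σ(τ(P))`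
(`map_tateR`, `map_tateNine`); so `τ(P) ∈ F` (`InfiniteGalois.mem_range_algebraMap_iff_fixed`);
the `j`-relation is B5 at `P` transported by `variableChange_j` / `j` of a base change. -/
theorem exists_hauptmodul_thirteen_of_torsion [IsGalois F L] [W.IsElliptic]
    {P : (W.baseChange L).toAffine.Point} (h13 : addOrderOf P = 13)
    (hσ : ∀ σ : L ≃ₐ[F] L, σ • P ∈ AddSubgroup.zmultiples P) :
    ∃ t : F, t ≠ 0 ∧
      W.j = (t ^ 2 + 5 * t + 13) * (t ^ 4 + 7 * t ^ 3 + 20 * t ^ 2 + 19 * t + 1) ^ 3 / t := by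
  sorry

/-- **B6 packaging — PROVED modulo `exists_hauptmodul_thirteen_of_torsion`** (copy of
`Isogeny.exists_hauptmodul_nine_of_isCyclic`; a kernel of prime order `13` is cyclic). -/
theorem Isogeny.exists_hauptmodul_thirteen_of_degree_eq {K : Type u} [Field K] [CharZero K]
    {W W' : WeierstrassCurve K} [W.IsElliptic] (φ : Isogeny W W') (hdeg : φ.degree = 13) :
    ∃ t : K, t ≠ 0 ∧
      W.j = (t ^ 2 + 5 * t + 13) * (t ^ 4 + 7 * t ^ 3 + 20 * t ^ 2 + 19 * t + 1) ^ 3 / t := by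
  haveI : IsGalois K (AlgebraicClosure K) := {}
  haveI : Fact (Nat.Prime 13) := ⟨by norm_num⟩
  have hcard : Nat.card φ.toAddMonoidHom.ker = 13 := hdeg
  haveI : IsAddCyclic φ.toAddMonoidHom.ker := isAddCyclic_of_prime_card hcard
  obtain ⟨g, hg⟩ := IsAddCyclic.exists_ofOrder_eq_natCard (α := φ.toAddMonoidHom.ker)
  have hordP : addOrderOf (g : W.geomPoints) = 13 := by
    rw [AddSubgroup.addOrderOf_coe, hg]
    exact hdeg
  have hgen : AddSubgroup.zmultiples (g : W.geomPoints) = φ.toAddMonoidHom.ker := by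
    apply AddSubgroup.eq_of_le_of_card_ge (AddSubgroup.zmultiples_le.mpr g.2)
    rw [Nat.card_zmultiples, hordP]
    exact hdeg.le
  have hg0 : φ (g : W.geomPoints) = 0 := (AddMonoidHom.mem_ker).mp g.2
  have hst : ∀ σ : Field.absoluteGaloisGroup K,
      σ • (g : W.geomPoints) ∈ AddSubgroup.zmultiples (g : W.geomPoints) := fun σ => by
    rw [hgen, AddMonoidHom.mem_ker, Isogeny.coe_toAddMonoidHom, φ.map_smul, hg0, smul_zero]
  exact exists_hauptmodul_thirteen_of_torsion (W := W) (L := AlgebraicClosure K)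
    (P := (g : W.geomPoints)) hordP hst

end WeierstrassCurve

/-! ## Assembly: KF13 discharged, and the crux on the smaller trust base -/

namespace Summit.ABC.ABC.Cruxes.DefiniteRTControlPrime.Sketch.Ideas1g6

open WeierstrassCurve Literature.NumberTheory.EllipticCurves

/-- **KF13 — PROVED modulo B2–B7** (the named fact `kleinFrickeThirteen_exists_j_eq` of
`KleinFrickeLevelThirteen.lean`, universe `0`). -/
theorem kleinFrickeThirteen_exists_j_eq_holds : kleinFrickeThirteen_exists_j_eq :=
  fun φ hdeg => Isogeny.exists_hauptmodul_thirteen_of_degree_eq φ hdeg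

/-- **`h5` token — PROVED in the tree**: k2-g3's hypothesis `FreyFiveIrreducible` (same text) is
`hasIrreducibleModPGaloisRep_freyCurve_five` (`DefiniteXiFreyModularitySketchReshape3.lean`). -/
def FreyFiveIrreducible : Prop :=
  ∀ (a b : ℤ), IsCoprime a b → (h0 : a * b * (a + b) ≠ 0) →
    haveI := isElliptic_freyCurve h0
    (freyCurve a b).HasIrreducibleModPGaloisRep 5

/-- `h5` token: `fun _ _ hab h0 => Summit.ABC.ABC.Theorems.hasIrreducibleModPGaloisRep_freyCurve_five hab h0`
(module `Summits.ABC.ABC.Theorems.DefiniteXiFreyModularitySketchReshape3`, not imported in this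
check because its import closure is being rebuilt on the farm at the time of writing). -/
theorem freyFiveIrreducible_holds
    (h : ∀ {a b : ℤ}, IsCoprime a b → (h0 : a * b * (a + b) ≠ 0) →
      haveI := isElliptic_freyCurve h0
      (freyCurve a b).HasIrreducibleModPGaloisRep 5) :
    FreyFiveIrreducible :=
  fun _ _ hab h0 => h hab h0

/-- **Net effect on the skeleton (statement only; the proof IS k2-g4's
`definiteRTControlPrime_of_rooted hT (StubIdeas2G3.freyIsogenyRadius163 h44 h13 h5)` with
`h13 := kleinFrickeThirteen_exists_j_eq_holds`, `h5 := freyFiveIrreducible_holds` — both crux-dir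
modules, not imported here):** the crux from Takahashi 2.3 and Mazur Cor. 4.4 ALONE. -/
def CruxFromTakahashiAndCor44 : Prop :=
  takahashi2001_thm_2_3_of_coprime → Mazur1978.cor44_valuation_j_le_one →
    Summit.ABC.ABC.Theses.DefiniteXi.DefiniteRTControlPrime

end Summit.ABC.ABC.Cruxes.DefiniteRTControlPrime.Sketch.Ideas1g6

end
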